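import Summits.AtomisticToContinuum.Crystallization.Theorems.ExcessDecayLiouvilleEnergyIdentity
import Summits.AtomisticToContinuum.Crystallization.Theorems.ExcessDecayLiouvilleHcpLiouvilleBlowdownSecantRows

/-!
# `ExcessDecayLiouville.HcpLiouville` (stmt-AtomisticToContinuum-9332), line `Sketch` (skeleton v4): rows of the force-constant operator on a cut-off field

Helper for the registered sub-goal `blowdown_linCaccioppoli` (part D1 of stub `stub_interior` of the blow-down):
the row book-keeping of the LINEAR Caccioppoli inequality for the force-constant operator `L` of an admissible
two-lattice `S = Sites₀ t A` (`Adm₀ A`, `Inner₀ t A`), test field `w = η (ζ − m₁)` on the sites for an ARBITRARY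
field `ζ`, a constant `m₁` and a scalar cut-off `η` (`B = S ∩ B_{ρK}(c)` a ball outside which `w` vanishes):

* `Blowdown.forceConst_neg/sub_comm/zero`, `Blowdown.inner_forceConst_comm` — `K(−e) = K(e)`, `K(0) = 0`, `K(e)`
  symmetric; `Blowdown.norm_forceConst_le_ker` — `‖K(p − q)‖ ≤ k(p,q)` (`LevelOne.ker`) between sites;
* `Blowdown.tsum_ball_eq_sum` — `tsum`s over the sites of a closed ball are finite sums over `finite_sites_ball`;
* `Blowdown.mul_nnForm_le_tsum_inner` — STABILITY IN OPERATOR FORM: `κ·nnForm(w) ≤ Σ'_p ⟪Σ'_q K_pq(w p − w q), w p⟫`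
  for finitely supported `w` on the sites (`Blowdown.PSIneq κ t A` and `energy_identity`);
* `Blowdown.row_split` — `Σ'_q K_pq(w p − w q) = Σ_{q∈B} K_pq(w p − w q) + Σ'_{q∉B} K_pq(w p)`, the far part being
  `≤ (K₀/δ⁵)‖w p‖` for `p ∈ B_{ρ₁+δ}(c)`, `ρ₁ + 2δ ≤ ρK` (`Blowdown.norm_tsum_far_row_le`);
* `Blowdown.inner_sum_row_testField` —
  `⟪Σ_{q∈B} K_pq(w p − w q), w p⟫ = η_p²⟪Σ_{q∈B} K_pq(ζ p − ζ q), ζ p − m₁⟫ + η_p Σ_{q∈B} (η_p − η_q)⟪K_pq(ζ q − m₁), ζ p − m₁⟫`;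
* `Blowdown.sum_mul_sub_mul_symm` — `Σ_{p,q} a_p(a_p − a_q)g(p,q) = ½Σ_{p,q}(a_p − a_q)²g(p,q)` for symmetric `g`;
* `Blowdown.comm_term_le` (registered carrier `blowdown_linRows`) — for a `δ⁻¹`-Lipschitz `η`,
  `Σ_{p,q∈P}(η_p − η_q)²⟪K_pq(ζ q − m₁), ζ p − m₁⟫ ≤ K₀δ⁻²·Σ_{p∈P}‖ζ p − m₁‖²`.

All `[folklore]`; a `--supports` helper for item stmt-AtomisticToContinuum-9332, nothing here closes an item.
-/

noncomputable section

namespace Summit.AtomisticToContinuum.Crystallization.Theorems.ExcessDecayLiouville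

open scoped BigOperators Topology Classical InnerProductSpace RealInnerProductSpace
open Literature.MathematicalPhysics.StatisticalMechanics
open Summit.AtomisticToContinuum.Crystallization.Theses.ExcessDecayLiouville
open Summit.AtomisticToContinuum.Crystallization.Theorems.PhononStabilityNegative

namespace Blowdown

open LevelOne

variable {t : Fin 2 → (EuclideanSpace ℝ (Fin 3))}
  {A : (EuclideanSpace ℝ (Fin 3)) →L[ℝ] (EuclideanSpace ℝ (Fin 3))}

/-! ## Algebra of the force-constant operator -/

/-- `K(−e) = K(e)`: the force-constant operator is even in the bond. [folklore] -/
theorem forceConst_neg (e : EuclideanSpace ℝ (Fin 3)) : forceConst (-e) = forceConst e := by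
  ext x i
  simp [forceConst_apply, norm_neg, inner_neg_left, smul_neg, neg_smul]

/-- `K(p − q) = K(q − p)`. [folklore] -/
theorem forceConst_sub_comm (p q : EuclideanSpace ℝ (Fin 3)) : forceConst (p - q) = forceConst (q - p) := by
  rw [← neg_sub, forceConst_neg]

/-- `K(0) = 0` (Lean's `0⁻¹ = 0`). [folklore] -/
theorem forceConst_zero : forceConst (0 : EuclideanSpace ℝ (Fin 3)) = 0 := by
  ext x i
  simp [forceConst_apply]

/-- `K(e)` is a symmetric operator: `⟪K(e)x, y⟫ = ⟪K(e)y, x⟫`. [folklore] -/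
theorem inner_forceConst_comm (e x y : EuclideanSpace ℝ (Fin 3)) :
    ⟪forceConst e x, y⟫ = ⟪forceConst e y, x⟫ := by
  simp only [forceConst_apply, inner_add_left, real_inner_smul_left]
  rw [real_inner_comm x y]
  ring

/-- `‖K(p − q)‖ ≤ k(p,q)` for sites `p, q` (`‖K(w)‖ ≤ 38|w|⁻⁸`, sites are `23/25`-separated, `K(0) = 0`).
[folklore] -/
theorem norm_forceConst_le_ker (hA : Adm₀ A) (hI : Inner₀ t A) {p q : EuclideanSpace ℝ (Fin 3)}
    (hp : p ∈ Sites₀ t A) (hq : q ∈ Sites₀ t A) : ‖forceConst (p - q)‖ ≤ ker p q := by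
  by_cases h : p = q
  · rw [h, sub_self, forceConst_zero, norm_zero, ker_self]
  · rw [ker_of_ne h]
    have hd : (23 / 25 : ℝ) ≤ dist p q := dist_sites_ge hA hI hp hq h
    have he : 9 / 10 ≤ ‖p - q‖ := by rw [← dist_eq_norm]; linarith
    refine (norm_forceConst_le he).trans ?_
    rw [← dist_eq_norm]
    have h8 : 0 ≤ (dist p q)⁻¹ ^ 8 := by positivity
    nlinarith

/-- `‖K(p − q)x‖ ≤ k(p,q)‖x‖` for sites `p, q`. [folklore] -/
theorem norm_forceConst_apply_le_ker (hA : Adm₀ A) (hI : Inner₀ t A) {p q : EuclideanSpace ℝ (Fin 3)}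
    (hp : p ∈ Sites₀ t A) (hq : q ∈ Sites₀ t A) (x : EuclideanSpace ℝ (Fin 3)) :
    ‖forceConst (p - q) x‖ ≤ ker p q * ‖x‖ :=
  (ContinuousLinearMap.le_opNorm _ _).trans
    (mul_le_mul_of_nonneg_right (norm_forceConst_le_ker hA hI hp hq) (norm_nonneg _))

/-! ## `tsum`s over the sites of a ball -/

/-- A `tsum` over the sites of a closed ball is a `tsum` over all sites with an indicator. [folklore] -/
theorem tsum_ball_eq_tsum_ite {M : Type*} [AddCommMonoid M] [TopologicalSpace M]
    (S : Set (EuclideanSpace ℝ (Fin 3))) (c : EuclideanSpace ℝ (Fin 3)) (r : ℝ)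
    (f : EuclideanSpace ℝ (Fin 3) → M) :
    ∑' p : {s : EuclideanSpace ℝ (Fin 3) // s ∈ S ∧ dist s c ≤ r}, f p =
      ∑' p : S, if dist (p : EuclideanSpace ℝ (Fin 3)) c ≤ r then f p else 0 := by
  have h1 := tsum_subtype {s : EuclideanSpace ℝ (Fin 3) | s ∈ S ∧ dist s c ≤ r} f
  have h2 := tsum_subtype S (fun p => if dist p c ≤ r then f p else 0)
  refine (h1.trans (tsum_congr fun x => ?_)).trans h2.symm
  by_cases hx : x ∈ S
  · by_cases hd : dist x c ≤ r
    · rw [Set.indicator_of_mem (show x ∈ {s : EuclideanSpace ℝ (Fin 3) | s ∈ S ∧ dist s c ≤ r} from ⟨hx, hd⟩),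
        Set.indicator_of_mem hx, if_pos hd]
    · rw [Set.indicator_of_notMem
        (show x ∉ {s : EuclideanSpace ℝ (Fin 3) | s ∈ S ∧ dist s c ≤ r} from fun h => hd h.2),
        Set.indicator_of_mem hx, if_neg hd]
  · rw [Set.indicator_of_notMem
      (show x ∉ {s : EuclideanSpace ℝ (Fin 3) | s ∈ S ∧ dist s c ≤ r} from fun h => hx h.1),
      Set.indicator_of_notMem hx]

/-- A `tsum` over the sites of a closed ball is the finite sum over `finite_sites_ball`. [folklore] -/
theorem tsum_ball_eq_sum {M : Type*} [AddCommMonoid M] [TopologicalSpace M] (hA : Adm₀ A) (hI : Inner₀ t A)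
    (c : EuclideanSpace ℝ (Fin 3)) (r : ℝ) (f : EuclideanSpace ℝ (Fin 3) → M) :
    ∑' p : {s : EuclideanSpace ℝ (Fin 3) // s ∈ Sites₀ t A ∧ dist s c ≤ r}, f p =
      ∑ p ∈ (finite_sites_ball hA hI c r).toFinset, f p := by
  rw [tsum_ball_eq_tsum_ite, tsum_eq_sum (s := (finite_sites_ball hA hI c r).toFinset)]
  · exact Finset.sum_congr rfl fun p hp => if_pos ((Set.Finite.mem_toFinset _).1 hp)
  · intro p hp
    exact if_neg fun h => hp ((Set.Finite.mem_toFinset _).2 h)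

/-! ## Stability in operator form -/

/-- **Stability in operator form**: `κ·nnForm(w) ≤ Σ'_p ⟪Σ'_q K(p−q)(w p − w q), w p⟫` for a finitely supported
field `w` on the sites (`PSIneq` and `energy_identity`; the diagonal term is `K(0)0 = 0`). [folklore] -/
theorem mul_nnForm_le_tsum_inner {κ : ℝ} (hA : Adm₀ A) (hI : Inner₀ t A) (hPS : PSIneq κ t A)
    {w : EuclideanSpace ℝ (Fin 3) → EuclideanSpace ℝ (Fin 3)} (hfin : (Function.support w).Finite)
    (hsub : Function.support w ⊆ Sites₀ t A) :
    κ * nnForm t A w ≤ ∑' p : Sites₀ t A,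
      ⟪∑' q : Sites₀ t A, forceConst ((p : EuclideanSpace ℝ (Fin 3)) - q) (w p - w q), w p⟫ := by
  have h1 := hPS w hfin hsub
  have h2 := energy_identity hA hI hfin
  have h3 : (∑' p : Sites₀ t A,
      ⟪∑' q : Sites₀ t A, forceConst ((p : EuclideanSpace ℝ (Fin 3)) - q) (w p - w q), w p⟫) =
      ∑' p : Sites₀ t A, ⟪∑' q : Sites₀ t A, (if (p : EuclideanSpace ℝ (Fin 3)) ≠ q then
        ((-((‖(p : EuclideanSpace ℝ (Fin 3)) - q‖ ^ 2)⁻¹) ^ 7 +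
            ((‖(p : EuclideanSpace ℝ (Fin 3)) - q‖ ^ 2)⁻¹) ^ 4) • (w p - w q) +
          (2 * ⟪(p : EuclideanSpace ℝ (Fin 3)) - q, w p - w q⟫ *
            (7 * ((‖(p : EuclideanSpace ℝ (Fin 3)) - q‖ ^ 2)⁻¹) ^ 8 -
              4 * ((‖(p : EuclideanSpace ℝ (Fin 3)) - q‖ ^ 2)⁻¹) ^ 5)) •
            ((p : EuclideanSpace ℝ (Fin 3)) - q)) else 0), w p⟫ := by
    refine tsum_congr fun p => ?_
    congr 1
    refine tsum_congr fun q => ?_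
    by_cases hpq : (p : EuclideanSpace ℝ (Fin 3)) = q
    · simp [hpq]
    · rw [if_pos hpq, forceConst_apply]
  rw [h3, h2]
  unfold hessForm at h1
  linarith

/-! ## The row split at the ball `B_{ρK}(c)` -/

/-- The far part of an operator row applied to a FIXED vector is absolutely summable (`‖K(p−q)‖ ≤ k(p,q)`).
[folklore] -/
theorem summable_far_row (hA : Adm₀ A) (hI : Inner₀ t A) (c : EuclideanSpace ℝ (Fin 3)) (ρK : ℝ)
    (p : Sites₀ t A) (x : EuclideanSpace ℝ (Fin 3)) :
    Summable fun q : Sites₀ t A =>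
      if ρK < dist (q : EuclideanSpace ℝ (Fin 3)) c then forceConst ((p : EuclideanSpace ℝ (Fin 3)) - q) x
      else 0 := by
  refine Summable.of_norm_bounded ((summable_ker hA hI p.2).mul_right ‖x‖) fun q => ?_
  split_ifs
  · exact norm_forceConst_apply_le_ker hA hI p.2 q.2 x
  · rw [norm_zero]; exact mul_nonneg (ker_nonneg _ _) (norm_nonneg _)

/-- **Row split** at the ball `B_{ρK}(c)` for a field vanishing on the sites outside the ball:
`Σ'_q K(p−q)(w p − w q) = Σ_{q ∈ S∩B_{ρK}} K(p−q)(w p − w q) + Σ'_{q ∉ B_{ρK}} K(p−q)(w p)`. [folklore] -/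
theorem row_split (hA : Adm₀ A) (hI : Inner₀ t A) {w : EuclideanSpace ℝ (Fin 3) → EuclideanSpace ℝ (Fin 3)}
    {c : EuclideanSpace ℝ (Fin 3)} {ρK : ℝ}
    (hw : ∀ q : Sites₀ t A, ρK < dist (q : EuclideanSpace ℝ (Fin 3)) c → w q = 0) (p : Sites₀ t A) :
    ∑' q : Sites₀ t A, forceConst ((p : EuclideanSpace ℝ (Fin 3)) - q) (w p - w q) =
      ∑ q ∈ (finite_sites_ball hA hI c ρK).toFinset, forceConst ((p : EuclideanSpace ℝ (Fin 3)) - q) (w p - w q) +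
        ∑' q : Sites₀ t A, (if ρK < dist (q : EuclideanSpace ℝ (Fin 3)) c then
          forceConst ((p : EuclideanSpace ℝ (Fin 3)) - q) (w p) else 0) := by
  set P := (finite_sites_ball hA hI c ρK).toFinset with hP
  have hmem : ∀ q : Sites₀ t A, q ∈ P ↔ dist (q : EuclideanSpace ℝ (Fin 3)) c ≤ ρK := fun q => by
    rw [hP, Set.Finite.mem_toFinset]; rfl
  have hsplit : ∀ q : Sites₀ t A, forceConst ((p : EuclideanSpace ℝ (Fin 3)) - q) (w p - w q) =
      (if q ∈ P then forceConst ((p : EuclideanSpace ℝ (Fin 3)) - q) (w p - w q) else 0) +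
        (if ρK < dist (q : EuclideanSpace ℝ (Fin 3)) c then
          forceConst ((p : EuclideanSpace ℝ (Fin 3)) - q) (w p) else 0) := by
    intro q
    by_cases hq : dist (q : EuclideanSpace ℝ (Fin 3)) c ≤ ρK
    · rw [if_pos ((hmem q).2 hq), if_neg (not_lt.2 hq), add_zero]
    · rw [if_neg (fun h => hq ((hmem q).1 h)), if_pos (not_le.1 hq), hw q (not_le.1 hq), sub_zero, zero_add]
  have hfin : Summable fun q : Sites₀ t A =>
      if q ∈ P then forceConst ((p : EuclideanSpace ℝ (Fin 3)) - q) (w p - w q) else 0 :=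
    summable_of_ne_finset_zero (s := P) fun q hq => if_neg hq
  have h1 : ∑' q : Sites₀ t A, (if q ∈ P then forceConst ((p : EuclideanSpace ℝ (Fin 3)) - q) (w p - w q) else 0) =
      ∑ q ∈ P, forceConst ((p : EuclideanSpace ℝ (Fin 3)) - q) (w p - w q) := by
    rw [tsum_eq_sum (s := P)]
    · exact Finset.sum_congr rfl fun q hq => if_pos hq
    · intro q hq
      exact if_neg hq
  rw [tsum_congr hsplit, hfin.tsum_add (summable_far_row hA hI c ρK p (w p)), h1]

/-- **Far rows are small on the support**: for a site `p ∈ B_{ρ₁+δ}(c)` and `ρ₁ + 2δ ≤ ρK`, every site outside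
`B_{ρK}(c)` is at distance `≥ δ` from `p`, so `‖Σ'_{q ∉ B_{ρK}} K(p−q)x‖ ≤ (K₀/δ⁵)‖x‖` (`δ ≥ 1`). [folklore] -/
theorem norm_tsum_far_row_le (hA : Adm₀ A) (hI : Inner₀ t A) {c : EuclideanSpace ℝ (Fin 3)} {ρ₁ δ ρK : ℝ}
    (hδ : 1 ≤ δ) (hK : ρ₁ + 2 * δ ≤ ρK) (p : Sites₀ t A)
    (hpc : dist (p : EuclideanSpace ℝ (Fin 3)) c ≤ ρ₁ + δ) (x : EuclideanSpace ℝ (Fin 3)) :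
    ‖∑' q : Sites₀ t A, (if ρK < dist (q : EuclideanSpace ℝ (Fin 3)) c then
        forceConst ((p : EuclideanSpace ℝ (Fin 3)) - q) x else 0)‖ ≤ K₀ / δ ^ 5 * ‖x‖ := by
  have hK₀ := K₀_pos
  have hbound : ∀ q : Sites₀ t A, ‖(if ρK < dist (q : EuclideanSpace ℝ (Fin 3)) c then
      forceConst ((p : EuclideanSpace ℝ (Fin 3)) - q) x else 0)‖ ≤
      (if δ ≤ dist (q : EuclideanSpace ℝ (Fin 3)) p then ker p q else 0) * ‖x‖ := by
    intro q
    split_ifs with h1 h2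
    · exact norm_forceConst_apply_le_ker hA hI p.2 q.2 x
    · exfalso
      have := dist_triangle (q : EuclideanSpace ℝ (Fin 3)) p c
      linarith
    · rw [norm_zero]; exact mul_nonneg (ker_nonneg _ _) (norm_nonneg _)
    · rw [norm_zero, zero_mul]
  have hsn : Summable fun q : Sites₀ t A => ‖(if ρK < dist (q : EuclideanSpace ℝ (Fin 3)) c then
      forceConst ((p : EuclideanSpace ℝ (Fin 3)) - q) x else 0)‖ := by
    refine ((summable_ker hA hI p.2).mul_right ‖x‖).of_nonneg_of_le (fun _ => norm_nonneg _) fun q => ?_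
    refine (hbound q).trans (mul_le_mul_of_nonneg_right ?_ (norm_nonneg _))
    split_ifs
    · exact le_rfl
    · exact ker_nonneg _ _
  refine (norm_tsum_le_tsum_norm hsn).trans (tsum_le_of_sum_le' (by positivity) fun F => ?_)
  calc ∑ q ∈ F, ‖(if ρK < dist (q : EuclideanSpace ℝ (Fin 3)) c then
        forceConst ((p : EuclideanSpace ℝ (Fin 3)) - q) x else 0)‖
      ≤ ∑ q ∈ F, (if δ ≤ dist (q : EuclideanSpace ℝ (Fin 3)) p then ker p q else 0) * ‖x‖ :=
        Finset.sum_le_sum fun q _ => hbound q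
    _ = (∑ q ∈ F, (if δ ≤ dist (q : EuclideanSpace ℝ (Fin 3)) p then ker p q else 0)) * ‖x‖ :=
        (Finset.sum_mul _ _ _).symm
    _ ≤ K₀ / δ ^ 5 * ‖x‖ := mul_le_mul_of_nonneg_right (sum_ker_far_le_K₀ hA hI _ hδ F) (norm_nonneg _)

/-! ## The finite part of a row on the test field `w = η (ζ − m₁)` -/

/-- **The finite part of a row on the test field** `w = η(ζ − m₁)` (on the sites):
`Σ_{q∈B} K_pq(w p − w q) = η_p • Σ_{q∈B} K_pq(ζ p − ζ q) + Σ_{q∈B} (η_p − η_q) • K_pq(ζ q − m₁)`. [folklore] -/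
theorem sum_row_testField {w ζ : EuclideanSpace ℝ (Fin 3) → EuclideanSpace ℝ (Fin 3)}
    {η : EuclideanSpace ℝ (Fin 3) → ℝ} {m₁ : EuclideanSpace ℝ (Fin 3)}
    (hwS : ∀ p : Sites₀ t A, w p = η p • (ζ p - m₁)) (P : Finset (Sites₀ t A)) (p : Sites₀ t A) :
    ∑ q ∈ P, forceConst ((p : EuclideanSpace ℝ (Fin 3)) - q) (w p - w q) =
      η p • ∑ q ∈ P, forceConst ((p : EuclideanSpace ℝ (Fin 3)) - q) (ζ p - ζ q) +
        ∑ q ∈ P, (η p - η q) • forceConst ((p : EuclideanSpace ℝ (Fin 3)) - q) (ζ q - m₁) := by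
  rw [Finset.smul_sum, ← Finset.sum_add_distrib]
  refine Finset.sum_congr rfl fun q _ => ?_
  have h : w p - w q = η p • (ζ p - ζ q) + (η p - η q) • (ζ q - m₁) := by
    rw [hwS p, hwS q]
    module
  rw [h, map_add, map_smul, map_smul]

/-- **The finite part paired with `w p = η_p(ζ p − m₁)`**:
`⟪Σ_{q∈B} K_pq(w p − w q), w p⟫ = η_p²⟪Σ_{q∈B} K_pq(ζ p − ζ q), ζ p − m₁⟫ + η_p Σ_{q∈B} (η_p − η_q)⟪K_pq(ζ q − m₁), ζ p − m₁⟫`.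
[folklore] -/
theorem inner_sum_row_testField {w ζ : EuclideanSpace ℝ (Fin 3) → EuclideanSpace ℝ (Fin 3)}
    {η : EuclideanSpace ℝ (Fin 3) → ℝ} {m₁ : EuclideanSpace ℝ (Fin 3)}
    (hwS : ∀ p : Sites₀ t A, w p = η p • (ζ p - m₁)) (P : Finset (Sites₀ t A)) (p : Sites₀ t A) :
    ⟪∑ q ∈ P, forceConst ((p : EuclideanSpace ℝ (Fin 3)) - q) (w p - w q), w p⟫ =
      η p ^ 2 * ⟪∑ q ∈ P, forceConst ((p : EuclideanSpace ℝ (Fin 3)) - q) (ζ p - ζ q), ζ p - m₁⟫ +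
        η p * ∑ q ∈ P, (η p - η q) *
          ⟪forceConst ((p : EuclideanSpace ℝ (Fin 3)) - q) (ζ q - m₁), ζ p - m₁⟫ := by
  rw [sum_row_testField hwS P p, hwS p, inner_add_left, real_inner_smul_right, real_inner_smul_right]
  simp only [sum_inner, real_inner_smul_left]
  ring

/-! ## The commutator term -/

/-- **Symmetrisation**: for a symmetric `g`, `Σ_{p,q∈s} a_p(a_p − a_q)g(p,q) = ½Σ_{p,q∈s}(a_p − a_q)²g(p,q)`.
[folklore] -/
theorem sum_mul_sub_mul_symm {ι : Type*} (s : Finset ι) (a : ι → ℝ) (g : ι → ι → ℝ)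
    (hg : ∀ p q, g p q = g q p) :
    ∑ p ∈ s, ∑ q ∈ s, a p * (a p - a q) * g p q = 1 / 2 * ∑ p ∈ s, ∑ q ∈ s, (a p - a q) ^ 2 * g p q := by
  have h1 : ∑ p ∈ s, ∑ q ∈ s, a p * (a p - a q) * g p q = ∑ p ∈ s, ∑ q ∈ s, a q * (a q - a p) * g p q := by
    rw [Finset.sum_comm]
    exact Finset.sum_congr rfl fun p _ => Finset.sum_congr rfl fun q _ => by rw [hg]
  have h2 : ∑ p ∈ s, ∑ q ∈ s, (a p - a q) ^ 2 * g p q =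
      ∑ p ∈ s, ∑ q ∈ s, a p * (a p - a q) * g p q + ∑ p ∈ s, ∑ q ∈ s, a q * (a q - a p) * g p q := by
    rw [← Finset.sum_add_distrib]
    refine Finset.sum_congr rfl fun p _ => ?_
    rw [← Finset.sum_add_distrib]
    exact Finset.sum_congr rfl fun q _ => by ring
  rw [h2, ← h1]
  ring

/-- **The commutator term**: `Σ_{p,q∈B}(η_p − η_q)²⟪K_pq(ζ q − m₁), ζ p − m₁⟫ ≤ K₀δ⁻²·Σ_{p∈B}‖ζ p − m₁‖²`
(`(η_p − η_q)² ≤ dist²/δ²`, `‖K_pq‖ ≤ k(p,q)`, `ab ≤ (a² + b²)/2`, `Σ dist²·k ≤ K₀` row- and column-wise).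
[folklore] -/
theorem comm_term_le (hA : Adm₀ A) (hI : Inner₀ t A) {η : EuclideanSpace ℝ (Fin 3) → ℝ} {δ : ℝ} (hδ : 0 < δ)
    (hηl : ∀ x y, |η x - η y| ≤ dist x y / δ) (ζ : EuclideanSpace ℝ (Fin 3) → EuclideanSpace ℝ (Fin 3))
    (m₁ : EuclideanSpace ℝ (Fin 3)) (P : Finset (Sites₀ t A)) :
    ∑ p ∈ P, ∑ q ∈ P, (η p - η q) ^ 2 *
        ⟪forceConst ((p : EuclideanSpace ℝ (Fin 3)) - q) (ζ q - m₁), ζ p - m₁⟫ ≤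
      K₀ / δ ^ 2 * ∑ p ∈ P, ‖ζ p - m₁‖ ^ 2 := by
  have hpt : ∀ p q : Sites₀ t A, (η p - η q) ^ 2 *
      ⟪forceConst ((p : EuclideanSpace ℝ (Fin 3)) - q) (ζ q - m₁), ζ p - m₁⟫ ≤
      dist (q : EuclideanSpace ℝ (Fin 3)) p ^ 2 * ker p q / δ ^ 2 *
        ((‖ζ p - m₁‖ ^ 2 + ‖ζ q - m₁‖ ^ 2) / 2) := by
    intro p q
    have h1 : (η p - η q) ^ 2 ≤ dist (q : EuclideanSpace ℝ (Fin 3)) p ^ 2 / δ ^ 2 := by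
      rw [← sq_abs, ← div_pow, dist_comm]
      exact pow_le_pow_left₀ (abs_nonneg _) (hηl p q) 2
    have h2 : |⟪forceConst ((p : EuclideanSpace ℝ (Fin 3)) - q) (ζ q - m₁), ζ p - m₁⟫| ≤
        ker p q * ((‖ζ p - m₁‖ ^ 2 + ‖ζ q - m₁‖ ^ 2) / 2) := by
      refine (abs_real_inner_le_norm _ _).trans ?_
      have h3 := norm_forceConst_apply_le_ker hA hI p.2 q.2 (ζ q - m₁)
      have h4 : ‖ζ q - m₁‖ * ‖ζ p - m₁‖ ≤ (‖ζ p - m₁‖ ^ 2 + ‖ζ q - m₁‖ ^ 2) / 2 := by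
        nlinarith [sq_nonneg (‖ζ q - m₁‖ - ‖ζ p - m₁‖)]
      calc ‖forceConst ((p : EuclideanSpace ℝ (Fin 3)) - q) (ζ q - m₁)‖ * ‖ζ p - m₁‖
          ≤ ker p q * ‖ζ q - m₁‖ * ‖ζ p - m₁‖ := mul_le_mul_of_nonneg_right h3 (norm_nonneg _)
        _ = ker p q * (‖ζ q - m₁‖ * ‖ζ p - m₁‖) := by ring
        _ ≤ ker p q * ((‖ζ p - m₁‖ ^ 2 + ‖ζ q - m₁‖ ^ 2) / 2) := mul_le_mul_of_nonneg_left h4 (ker_nonneg _ _)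
    calc (η p - η q) ^ 2 * ⟪forceConst ((p : EuclideanSpace ℝ (Fin 3)) - q) (ζ q - m₁), ζ p - m₁⟫
        ≤ (η p - η q) ^ 2 * |⟪forceConst ((p : EuclideanSpace ℝ (Fin 3)) - q) (ζ q - m₁), ζ p - m₁⟫| :=
          mul_le_mul_of_nonneg_left (le_abs_self _) (sq_nonneg _)
      _ ≤ dist (q : EuclideanSpace ℝ (Fin 3)) p ^ 2 / δ ^ 2 *
            (ker p q * ((‖ζ p - m₁‖ ^ 2 + ‖ζ q - m₁‖ ^ 2) / 2)) :=
          mul_le_mul h1 h2 (abs_nonneg _) (by positivity)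
      _ = _ := by ring
  have hrow : ∀ p : Sites₀ t A, ∑ q ∈ P, dist (q : EuclideanSpace ℝ (Fin 3)) p ^ 2 * ker p q / δ ^ 2 ≤ K₀ / δ ^ 2 :=
    fun p => by
      rw [← Finset.sum_div]
      exact div_le_div_of_nonneg_right (sum_distSq_mul_ker_le_K₀ hA hI p.2 P) (by positivity)
  have hcol : ∀ q : Sites₀ t A, ∑ p ∈ P, dist (q : EuclideanSpace ℝ (Fin 3)) p ^ 2 * ker p q / δ ^ 2 ≤ K₀ / δ ^ 2 :=
    fun q => by
      have h : ∑ p ∈ P, dist (q : EuclideanSpace ℝ (Fin 3)) p ^ 2 * ker p q / δ ^ 2 =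
          ∑ p ∈ P, dist (p : EuclideanSpace ℝ (Fin 3)) q ^ 2 * ker q p / δ ^ 2 :=
        Finset.sum_congr rfl fun p _ => by rw [dist_comm, ker_comm]
      rw [h, ← Finset.sum_div]
      exact div_le_div_of_nonneg_right (sum_distSq_mul_ker_le_K₀ hA hI q.2 P) (by positivity)
  have hsplit : ∑ p ∈ P, ∑ q ∈ P, dist (q : EuclideanSpace ℝ (Fin 3)) p ^ 2 * ker p q / δ ^ 2 *
      ((‖ζ p - m₁‖ ^ 2 + ‖ζ q - m₁‖ ^ 2) / 2) =
      ∑ p ∈ P, ‖ζ p - m₁‖ ^ 2 / 2 * ∑ q ∈ P, dist (q : EuclideanSpace ℝ (Fin 3)) p ^ 2 * ker p q / δ ^ 2 +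
        ∑ q ∈ P, ‖ζ q - m₁‖ ^ 2 / 2 * ∑ p ∈ P, dist (q : EuclideanSpace ℝ (Fin 3)) p ^ 2 * ker p q / δ ^ 2 := by
    have h : ∑ p ∈ P, ∑ q ∈ P, dist (q : EuclideanSpace ℝ (Fin 3)) p ^ 2 * ker p q / δ ^ 2 *
        ((‖ζ p - m₁‖ ^ 2 + ‖ζ q - m₁‖ ^ 2) / 2) =
        ∑ p ∈ P, ∑ q ∈ P, (‖ζ p - m₁‖ ^ 2 / 2 * (dist (q : EuclideanSpace ℝ (Fin 3)) p ^ 2 * ker p q / δ ^ 2) +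
          ‖ζ q - m₁‖ ^ 2 / 2 * (dist (q : EuclideanSpace ℝ (Fin 3)) p ^ 2 * ker p q / δ ^ 2)) :=
      Finset.sum_congr rfl fun p _ => Finset.sum_congr rfl fun q _ => by ring
    rw [h]
    simp only [Finset.sum_add_distrib]
    congr 1
    · simp_rw [Finset.mul_sum]
    · rw [Finset.sum_comm]
      simp_rw [Finset.mul_sum]
  have hO : 0 ≤ ∑ p ∈ P, ‖ζ p - m₁‖ ^ 2 := Finset.sum_nonneg fun p _ => sq_nonneg _
  calc ∑ p ∈ P, ∑ q ∈ P, (η p - η q) ^ 2 *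
        ⟪forceConst ((p : EuclideanSpace ℝ (Fin 3)) - q) (ζ q - m₁), ζ p - m₁⟫
      ≤ ∑ p ∈ P, ∑ q ∈ P, dist (q : EuclideanSpace ℝ (Fin 3)) p ^ 2 * ker p q / δ ^ 2 *
          ((‖ζ p - m₁‖ ^ 2 + ‖ζ q - m₁‖ ^ 2) / 2) :=
        Finset.sum_le_sum fun p _ => Finset.sum_le_sum fun q _ => hpt p q
    _ = _ := hsplit
    _ ≤ ∑ p ∈ P, ‖ζ p - m₁‖ ^ 2 / 2 * (K₀ / δ ^ 2) + ∑ q ∈ P, ‖ζ q - m₁‖ ^ 2 / 2 * (K₀ / δ ^ 2) :=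
        add_le_add (Finset.sum_le_sum fun p _ => mul_le_mul_of_nonneg_left (hrow p) (by positivity))
          (Finset.sum_le_sum fun q _ => mul_le_mul_of_nonneg_left (hcol q) (by positivity))
    _ = K₀ / δ ^ 2 * ∑ p ∈ P, ‖ζ p - m₁‖ ^ 2 := by
        rw [← Finset.sum_mul, ← Finset.sum_div]
        ring

end Blowdown

/-- Registered sub-goal carrying this helper file (crux stmt-AtomisticToContinuum-9332, line `Sketch`, skeleton v4;
helper of `blowdown_linCaccioppoli`): the commutator bound for a `δ⁻¹`-Lipschitz cut-off,
`Σ_{p,q∈P}(η_p − η_q)²⟪K_pq(ζ q − m₁), ζ p − m₁⟫ ≤ K₀δ⁻²·Σ_{p∈P}‖ζ p − m₁‖²`. [folklore] -/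
theorem blowdown_linRows : ∀ (t : Fin 2 → (EuclideanSpace ℝ (Fin 3))) (A : (EuclideanSpace ℝ (Fin 3)) →L[ℝ] (EuclideanSpace ℝ (Fin 3))), Adm₀ A → Inner₀ t A → ∀ (η : (EuclideanSpace ℝ (Fin 3)) → ℝ) (δ : ℝ), 0 < δ → (∀ x y : (EuclideanSpace ℝ (Fin 3)), |η x - η y| ≤ dist x y / δ) → ∀ (ζ : (EuclideanSpace ℝ (Fin 3)) → (EuclideanSpace ℝ (Fin 3))) (m₁ : (EuclideanSpace ℝ (Fin 3))) (P : Finset (Sites₀ t A)), ∑ p ∈ P, ∑ q ∈ P, (η p - η q) ^ 2 * inner ℝ (forceConst ((p : (EuclideanSpace ℝ (Fin 3))) - q) (ζ q - m₁)) (ζ p - m₁) ≤ LevelOne.K₀ / δ ^ 2 * ∑ p ∈ P, ‖ζ p - m₁‖ ^ 2 := by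
  intro t A hA hI η δ hδ hηl ζ m₁ P
  exact Blowdown.comm_term_le hA hI hδ hηl ζ m₁ P

end Summit.AtomisticToContinuum.Crystallization.Theorems.ExcessDecayLiouville

end
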